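import Literature.MathematicalPhysics.QuantumFieldTheory.ConformalBootstrap3D.PointKernelK34v2Data

/-!
# K34v2 certificate, kernel block file M0: (M) rows `0 ≤ j < 47` of `mrowsK34v2`, in 5 row groups

`decide` by kernel reduction of the (M) block checker `PCert.mBlockOK` of `PointKernel` on the literal
data of `PointKernelK34v2Data`; soundness is `PCert.mBlockOK_sound`.  Estimated kernel time 133 s.
-/

set_option maxRecDepth 100000
set_option maxHeartbeats 0

namespace Literature.MathematicalPhysics.QuantumFieldTheory.ConformalBootstrap3D.PointKernelK34v2

open Literature.MathematicalPhysics.QuantumFieldTheory.ConformalBootstrap3D.PointKernel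

/-- (M) rows `[0, 16)` pass the kernel evaluator. [folklore] -/
theorem mBlock_0 : certK34v2.mBlockOK mrowsK34v2 0 16 = true := by
  decide +kernel

/-- (M) rows `[16, 23)` pass the kernel evaluator. [folklore] -/
theorem mBlock_16 : certK34v2.mBlockOK mrowsK34v2 16 23 = true := by
  decide +kernel

/-- (M) rows `[23, 25)` pass the kernel evaluator. [folklore] -/
theorem mBlock_23 : certK34v2.mBlockOK mrowsK34v2 23 25 = true := by
  decide +kernel

/-- (M) rows `[25, 37)` pass the kernel evaluator. [folklore] -/
theorem mBlock_25 : certK34v2.mBlockOK mrowsK34v2 25 37 = true := by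
  decide +kernel

/-- (M) rows `[37, 47)` pass the kernel evaluator. [folklore] -/
theorem mBlock_37 : certK34v2.mBlockOK mrowsK34v2 37 47 = true := by
  decide +kernel

end Literature.MathematicalPhysics.QuantumFieldTheory.ConformalBootstrap3D.PointKernelK34v2
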